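import Summits.QuantumFields.YangMills.Theorems.BalabanUVNodesK3V6Stub1ProducerRoads
import Summits.QuantumFields.YangMills.Theorems.BalabanUVNodesN16PinnedLooseMatchSqueezeClassRadius
import HarnessLib

/-!
# Route «BalabanUVNodes», crux K3⁸ `SpineGivenEndpointR13SepCoPHV` (stmt-QuantumFields-27366; skeleton «v6» b4e55110ab73e679), node N16 = NE3: v6 STUB 1's TEXT AND K3⁸ BY NAME FROM
# NODE N05's `h5` + NODE N07's SLOT KEY + THE ROWS — the LIVE twins of dag-n27-w1's `…K3V6Stub1ProducerRoads` Theorem-1-keyed roads (whose `(hM, hT : ∀ k, Thm1At C (torusVP …))`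
# bundle is kernel-refuted), by ONE `obtain` on this seat's slot-keyed producers (modules 47 ∕ 50) and dag-n27-w1's ★★ `stub1TextV_of_n16Producer_of_rows`

Cell `pub-ymgap`, seat `pub-ymgap-dag-n16-e` (R134 acceleration seat (a), strategy s2 = BY-NAME KNIT at the record; HUMAN RULING D-0062; chair R424 venue), generation 17,
module 52 (THEOREMS ONLY, 0 `def`, 0 `sorry`, standard axioms).  `--kind proof --supports stmt-QuantumFields-27366 --as helper` (count-neutral; proves NO registered stub — the
conclusions are the REGISTERED `stub_rates13HV` TEXT ∕ the route decl UNDER DISPLAYED HYPOTHESES).  `bears_on: R4∕N16 · K3⁸ stub 1 · edges N05 → N16, N07 → N16`.  Over dag-n27-w1's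
`…K3V6Stub1ProducerRoads` (p631290: ★★ `stub1TextV_of_n16Producer_of_rows` — v6 stub 1's text from node N16's producer OUTPUT SHAPE + the U3 rows + def-W1's kernel letters, via the
minted all-pins reading `exists_reading_v5pins` and the slot bill `keyedRatesHolderD4V_rrOfRecord_of_pins_of_letters`) and `…K3V6Defs.spineGivenEndpointR13SepCoPHV_of_stubTextsV`,
this seat's module 47 `…N16PinnedLooseMatchOfReg910Slot.exists_letters_n16HolderAtReading_loose_of_h5_reg910Slot_match` (p615316) and module 50
`…N16PinnedLooseMatchSqueezeClassRadius.exists_letters_g_n16HolderAtReading_loose_squeezeFull_of_h5_reg910Slot` (p627812) — CITED BY NAME, none edited.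

WHY.  p631290's `stub1TextV_of_h5_thm1At_of_rows` ∕ `spineGivenEndpointR13SepCoPHV_of_h5_thm1At_of_rows_of_stub2TextV` key node N07's in-edge as `hM ∧ hT : ∀ k, Thm1At (C F)
(torusVP 4 F.L Nper (G F) (k+1))` over module 45; dag-n16-w2 `…N16Thm1AtTorusVPSmallCubes.not_stub_thm1At` (rank two) and dag-n16-w5 `…SmallCubesRankN` (every rank) REFUTE that
binder bundle (leaf-06's `torusVP` reads (9)–(10) on ALL cubes incl. the five-site one, D-s3-3), so those roads are VACUOUS AS TYPED.  dag-n16-w1's SLOT KEY `hR` (Theorem 1's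
regularity (9)–(10) for every minimiser over `sfClass (B₃ε₁)` with an `ε₁`-loose datum ON THE SLOT CUBE `K = L^{k+1} − 1 + L^{k+1} + 2` about every site; NOT refuted —
`N16SlotKeyWitnesses` p612064; WLOG `1 ≤ C.B₃` — `…N16SlotKeyUnit` p620319) is the live currency; modules 47 ∕ 50 produce node N16's share from `h5` + `hR` with the SAME output shape.

WHAT THIS FILE PROVES (kernel; every in-edge a DISPLAYED HYPOTHESIS).  ★★ `stub1TextV_of_h5_reg910Slot_match_of_rows` — the REGISTERED v6 `stub_rates13HV` TEXT (mirror
vocabulary) from `β ∈ ]2∕3,1[`, a coupling letter `g F > 0`, node N05's `h5` (37ᴴ's binder VERBATIM), the local-gauge shape `G F` with the (9)_{β₀=1} interface, constants `C F`,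
the SLOT KEY `hR`, the U3 letter rows and def-W1's four kernel letters (module 47 ∘ p631290 ★★).  ★★ `stub1TextV_of_h5_reg910Slot_squeeze_of_rows` — the same WITHOUT a coupling-letter
input: `g := gradConst 4 ∘ c'` is OUTPUT by module 50, whose letters also meet node N19′'s nine N16-letter rows and dag-n21-w6's floor `2^78·L^12 ≤ B` (the witness dag-n19-w3's
`…SqueezedK3V6` reads).  `spineGivenEndpointR13SepCoPHV_of_h5_reg910Slot_of_rows_of_stub2TextV` — K3⁸ BY NAME from those in-edges and the REGISTERED `stub_expansion13HV` text.

HONEST FRAMING.  Composite bookkeeping BY NAME in hypothesis form; NOT a proof of `stub_rates13HV` or `stub_expansion13HV`; every in-edge — node N05's `h5` ([B8] Thm 4 ∕ Prop 3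
bodies on the pinned all-torus members, exponent β; N06's m ≥ 1 binders behind), the slot key ([Balaban1985Variational] Thm 1 (9)–(10) p. 279 on the slot cubes — node N07's content),
the local-gauge interface, the U3 letter rows, def-W1's finite-volume kernel letters (NOT PRINTED as such for d = 4), stub 2's text — is a DISPLAYED hypothesis asserted for nothing;
nothing of Bałaban asserted or refuted; K3⁸ OPEN, NOT claimed; skeleton v6 UNTOUCHED; N05 ∕ N07 ∕ N16 ∕ N17 ∕ N18 ∕ N22 ∕ (D4) ∕ N27 NOT discharged; counts UNMOVED (typed 28∕28 ·
discharged 5∕27, A 5∕28); one finite four-torus at fixed ε — R4 closes the conditional rung `BalabanLadder.UV` only; NOT ℝ⁴ ∕ infinite volume ∕ OS ∕ mass gap ∕ Clay.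
-/

set_option autoImplicit false

open scoped BigOperators Matrix Matrix.Norms.L2Operator
open NormedSpace

namespace Summit.QuantumFields.YangMills.BalabanUVNodes.N16Stub1RoadOfSlotKey

open Literature.MathematicalPhysics.QuantumFieldTheory.Balaban1983to89
open Literature.MathematicalPhysics.QuantumFieldTheory.Balaban1983to89.T4Continuum (T4Family ULoop)
open Literature.MathematicalPhysics.QuantumFieldTheory.Balaban1983to89.B12Sec2to5 (betaPrime510)
open Literature.MathematicalPhysics.QuantumFieldTheory.Balaban1983to89.Node00.U3KernelLetters (PolLimitsExistOfRecord₁₃ WindowedNE9OfRecord₁₃ WindowedDecayOfRecord₁₃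
  WindowedStepRateOfRecord₁₃)
open B7Prop1Explicit B7Prop2Explicit MatrixLog UnitaryModel
open T4AveragingDeficitWall hiding Site Plaq Bond
open B7Prop3Flat (c3)
open B8LeafModelZd (ZdIdx)
open B8LeafModelZd3 (zdGF3)
open Node00 (Stage13HParams NE3Objects₁₁ NE3Letters₁₁ ne3ConstLayerOfRecord₁₁ ne3NperOfRecord₁₁ ne3DomOfRecord₁₁ MatA)
open Summit.QuantumFields.BalabanUV.T4Continuum
open Summit.QuantumFields.BalabanUV.T4Continuum.Spine
open MinimalActionSandwich (IsMinimiser)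
open MinimalActionRate (sfClass)
open MinimalActionRefine (gradConst)
open MinimalActionDictionary (torusVP RadiiMono)
open AveragingDeficitLatticeH2Prep (fd)
open B11 (Regularity)
open YMDAG.UVSplit (RateReading₁₃CoPH ShellSplit₁₃CoPH)
open Summit.QuantumFields.YangMills.BalabanUVNodes.N16HolderDefs (N16HolderAt)
open Summit.QuantumFields.YangMills.BalabanUVNodes.N16PinnedLayer13CoPH (N16PinnedLoose N16LettersEnd N16HolderAtReading)
open Summit.QuantumFields.YangMills.BalabanUVNodes.N16PinnedLooseMatchOfReg910Slot (exists_letters_n16HolderAtReading_loose_of_h5_reg910Slot_match)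
open Summit.QuantumFields.YangMills.BalabanUVNodes.N16PinnedLooseMatchSqueezeClassRadius (exists_letters_g_n16HolderAtReading_loose_squeezeFull_of_h5_reg910Slot)
open Summit.QuantumFields.YangMills.Theorems.K3V5Defs
open Summit.QuantumFields.YangMills.Theorems.K3V6Defs

noncomputable section

section Rows

variable (β : ℝ) (hβ : 2 / 3 < β) (hβ' : β < 1) (ℓ : LetterReading) (g : T4Family → ℝ) (s : (F : T4Family) → Stage13HParams F 2 → ℕ)
  -- the U3 letter block's rows
  (hs : ∀ (F : T4Family) (θ : Stage13HParams F 2), θ.Provisos₁₃CoPH F 2 → (θ.ZhUnity F 2 ∧ θ.SlotsNondegenerate₁₃ F 2) → θ.Admissible F 2 → (ℓ F θ).Signs)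
  (hκ : ∀ (F : T4Family) (θ : Stage13HParams F 2), θ.Provisos₁₃CoPH F 2 → (θ.ZhUnity F 2 ∧ θ.SlotsNondegenerate₁₃ F 2) → θ.Admissible F 2 → 0 < (ℓ F θ).κ)
  (hcr : ∀ (F : T4Family) (θ : Stage13HParams F 2), θ.Provisos₁₃CoPH F 2 → (θ.ZhUnity F 2 ∧ θ.SlotsNondegenerate₁₃ F 2) → θ.Admissible F 2 → betaPrime510 4 1 (ℓ F θ).κ ≤ (ℓ F θ).cr)
  (hρ : ∀ (F : T4Family) (θ : Stage13HParams F 2), θ.Provisos₁₃CoPH F 2 → (θ.ZhUnity F 2 ∧ θ.SlotsNondegenerate₁₃ F 2) → θ.Admissible F 2 → 0 ≤ (ℓ F θ).ρ ∧ (ℓ F θ).ρ < 1)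
  -- def-W1's four finite-volume kernel letters of record
  (hL : ∀ (F : T4Family) (θ : Stage13HParams F 2), θ.Provisos₁₃CoPH F 2 → (θ.ZhUnity F 2 ∧ θ.SlotsNondegenerate₁₃ F 2) → θ.Admissible F 2 → PolLimitsExistOfRecord₁₃ F 2 θ.toStage13Params)
  (h9 : ∀ (F : T4Family) (θ : Stage13HParams F 2), θ.Provisos₁₃CoPH F 2 → (θ.ZhUnity F 2 ∧ θ.SlotsNondegenerate₁₃ F 2) → θ.Admissible F 2 →
    WindowedNE9OfRecord₁₃ F 2 θ.toStage13Params (ℓ F θ).κ (ℓ F θ).moduli)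
  (hW : ∀ (F : T4Family) (θ : Stage13HParams F 2), θ.Provisos₁₃CoPH F 2 → (θ.ZhUnity F 2 ∧ θ.SlotsNondegenerate₁₃ F 2) → θ.Admissible F 2 →
    WindowedDecayOfRecord₁₃ F 2 θ.toStage13Params 0 1 (ℓ F θ).κ)
  (hS : ∀ (F : T4Family) (θ : Stage13HParams F 2), θ.Provisos₁₃CoPH F 2 → (θ.ZhUnity F 2 ∧ θ.SlotsNondegenerate₁₃ F 2) → θ.Admissible F 2 →
    WindowedStepRateOfRecord₁₃ F 2 θ.toStage13Params (s F θ) (ℓ F θ).κ (ℓ F θ).θ₅ ((ℓ F θ).C₅ * (ℓ F θ).θ₅))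
include hβ hβ' hs hκ hcr hρ hL h9 hW hS

/-- ★★ **v6 STUB 1's TEXT FROM NODE N05's `h5` AND THE SLOT KEY, BY NAME** — dag-n27-w1's `stub1TextV_of_h5_thm1At_of_rows` with `(hM, hT) ↦ hR`: the REGISTERED `stub_rates13HV`
text (mirror vocabulary) from `β ∈ ]2∕3, 1[`; a coupling letter `g F > 0`; node N05's `h5` (37ᴴ's binder VERBATIM); leaf-06's local-gauge shape `G F` (`RadiiMono`, the (9)_{β₀=1}
interface `hG`); constants `C F : B11Thm1.Consts`; the SLOT KEY `hR` ([Balaban1985Variational] Thm 1 (9)–(10) for every minimiser over `sfClass (B₃ε₁)` with an `ε₁`-loose datum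
ON THE SLOT CUBE about every site — dag-n16-w1 (T9ˢ), DISPLAYED, asserted for nothing, NOT refuted); the U3 letter rows; def-W1's four finite-volume kernel letters.  ONE `obtain` on
module 47's producer, then dag-n27-w1's ★★ `stub1TextV_of_n16Producer_of_rows`.  NOT a proof of the stub. [cite: Balaban1985Variational, Thm 1 (9)–(10) p.279] [bookkeeping] -/
theorem stub1TextV_of_h5_reg910Slot_match_of_rows (hg : ∀ F, 0 < g F)
    (h5 : ∀ F : T4Family, letI : CStarAlgebra (Matrix (Fin 2) (Fin 2) ℂ) := {}
      ∃ (len : Site 4 → ℝ) (c₁ c₁' B₁' cP C₂ B₀β : ℝ) (inp : B8.B9Inputs),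
        (∀ v : Site 4, 0 < len v → 1 ≤ len v) ∧ (∀ μ : Fin 4, len (e μ) = 1) ∧ 0 < B₁' ∧ 5 * ((4 : ℕ) : ℝ) * F.L * inp.B₀ ≤ B₁' ∧ 0 < c₁' ∧
        (∀ α₀ α₁ : ℝ, 0 < α₀ → 0 < α₁ → α₀ + α₁ ≤ c₁' →
          α₀ + α₁ ≤ c₁ ∧ C0 4 * (2 * α₀) ≤ 1 / 3 ∧ 4 * α₀ ≤ c2' 4 F.L ∧ 16 * (B₁' * (α₀ + α₁)) ≤ 1 ∧
          Real.exp (4 * (800 * (((4 : ℕ) : ℝ) + 1) ^ 2 * (((4 : ℕ) : ℝ) + 4)) * α₀) * (1 + 8 * (131072 * (((4 : ℕ) : ℝ) + 1) ^ 2) * (B₁' * (α₀ + α₁))) ≤ 2 ∧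
          2 * (B₁' * (α₀ + α₁)) ≤ c3 4 F.L ∧ ((4 : ℕ) : ℝ) * F.L * α₁ ≤ 1 / 8 ∧ α₀ ≤ cP ∧ α₁ ≤ cP ∧ B₁' * (α₀ + α₁) ≤ cP ∧
          2 * (B₁' * (α₀ + α₁)) ^ 2 + 20 * ((4 : ℕ) : ℝ) * α₀ * (B₁' * (α₀ + α₁)) + 2 * C₂ * (B₁' * (α₀ + α₁)) ^ 2 ≤ α₀ + α₁) ∧
        B8.Thm4Body c₁ B₁' (fun i : {i : ZdIdx 4 F.L // (∀ j, i.Ω j = Set.univ) ∧ (∀ m j, i.Λs m j = {_y | j = m}) ∧ (∀ m j, i.Λb m j = {_c | j = m}) ∧ i.η = ((F.L : ℝ)⁻¹) ^ i.k} => (zdGF3 (Matrix (Fin 2) (Fin 2) ℂ) F.L β len i.1).toGFData) ∧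
        B8.Prop3Body cP 4 (F.L : ℝ) C₂ inp B₀β (fun i : {i : ZdIdx 4 F.L // (∀ j, i.Ω j = Set.univ) ∧ (∀ m j, i.Λs m j = {_y | j = m}) ∧ (∀ m j, i.Λb m j = {_c | j = m}) ∧ i.η = ((F.L : ℝ)⁻¹) ^ i.k} => (zdGF3 (Matrix (Fin 2) (Fin 2) ℂ) F.L β len i.1).toGFData2))
    {G : T4Family → (Site 4 → Fin 4 → (MatA 2)ˣ) → Site 4 → ℕ → ℝ → ℝ → ℝ → Prop} (hGm : ∀ F, RadiiMono 4 (G F))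
    (hG : ∀ (F : T4Family) (U : Site 4 → Fin 4 → (MatA 2)ˣ) (x : Site 4) (K : ℕ) (α₀ α₁ α₂ : ℝ), 2 ≤ K → G F U x K α₀ α₁ α₂ →
      ∃ (u : Site 4 → (MatA 2)ˣ) (a : Site 4 → Fin 4 → MatA 2),
        (∀ z, u z ∈ unitaryUnits (MatA 2)) ∧
        (∀ (y : Site 4) (τ : Fin 4), l1 (y - x) ≤ 2 → ((gaugeAct u U y τ : (MatA 2)ˣ) : MatA 2) = exp (a y τ)) ∧
        (∀ (y : Site 4) (τ : Fin 4), l1 (y - x) ≤ 2 → ‖a y τ‖ ≤ α₀) ∧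
        (∀ (y : Site 4) (τ i : Fin 4), l1 (y - x) ≤ 1 → ‖fd i (fun z => a z τ) y‖ ≤ α₁) ∧
        (∀ (τ i l : Fin 4), ‖fd i (fd l (fun z => a z τ)) x‖ ≤ α₂))
    (C : T4Family → B11Thm1.Consts)
    (hR : ∀ (F : T4Family) (k : ℕ) (ε₁ : ℝ), 0 < ε₁ → ε₁ ≤ (C F).a₁ → ∀ (V U : Site 4 → Fin 4 → (MatA 2)ˣ), V ∈ sfClass 4 F.L (ne3NperOfRecord₁₁ F 0 0) ε₁ 0 →
      IsMinimiser 4 (sfClass 4 F.L (ne3NperOfRecord₁₁ F 0 0) ((C F).B₃ * ε₁)) F.L (ne3NperOfRecord₁₁ F 0 0) (k + 1) V U →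
        ∀ x : Site 4, Regularity (torusVP 4 F.L (ne3NperOfRecord₁₁ F 0 0) (G F) (k + 1)) (C F).B₃ (C F).B₄ ε₁ U (x, F.L ^ (k + 1) - 1 + F.L ^ (k + 1) + 2)) :
    ∃ β : ℝ, 2 / 3 < β ∧ β < 1 ∧
    ∃ (𝔯 : RateReading₁₃CoPH 2) (ksel : RunSel) (ℓ : LetterReading) (ℓ₃ : T4Family → Node00.NE3Letters₁₁) (g B : T4Family → ℝ),
      GuardedReadingN16 𝔯 ksel ℓ ℓ₃ g B ∧ KeyedRatesHolderD4V β (rrOfRecord 𝔯 ksel) := by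
  have hβ0 : 0 ≤ β := by linarith
  obtain ⟨ℓ₃, B, hE, hM', -, hH⟩ := exists_letters_n16HolderAtReading_loose_of_h5_reg910Slot_match (N := 2) hβ0 hβ'.le hg h5 hGm hG C hR
  exact stub1TextV_of_n16Producer_of_rows β hβ hβ' ℓ g s hs hκ hcr hρ hL h9 hW hS ⟨ℓ₃, B, hE, hM', hH⟩

/-- **K3⁸ BY NAME FROM NODE N05's `h5` + THE SLOT KEY + THE ROWS, AND v6 STUB 2's TEXT** (`K3V6Defs.spineGivenEndpointR13SepCoPHV_of_stubTextsV` ∘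
`stub1TextV_of_h5_reg910Slot_match_of_rows`) — the live twin of dag-n27-w1's `spineGivenEndpointR13SepCoPHV_of_h5_thm1At_of_rows_of_stub2TextV`.  Every in-edge a HYPOTHESIS; NOT a
proof of either stub; K3⁸ OPEN. [cite: Balaban1985Variational, Thm 1 (9)–(10) p.279] [bookkeeping] -/
theorem spineGivenEndpointR13SepCoPHV_of_h5_reg910Slot_of_rows_of_stub2TextV (hg : ∀ F, 0 < g F)
    (h5 : ∀ F : T4Family, letI : CStarAlgebra (Matrix (Fin 2) (Fin 2) ℂ) := {}
      ∃ (len : Site 4 → ℝ) (c₁ c₁' B₁' cP C₂ B₀β : ℝ) (inp : B8.B9Inputs),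
        (∀ v : Site 4, 0 < len v → 1 ≤ len v) ∧ (∀ μ : Fin 4, len (e μ) = 1) ∧ 0 < B₁' ∧ 5 * ((4 : ℕ) : ℝ) * F.L * inp.B₀ ≤ B₁' ∧ 0 < c₁' ∧
        (∀ α₀ α₁ : ℝ, 0 < α₀ → 0 < α₁ → α₀ + α₁ ≤ c₁' →
          α₀ + α₁ ≤ c₁ ∧ C0 4 * (2 * α₀) ≤ 1 / 3 ∧ 4 * α₀ ≤ c2' 4 F.L ∧ 16 * (B₁' * (α₀ + α₁)) ≤ 1 ∧
          Real.exp (4 * (800 * (((4 : ℕ) : ℝ) + 1) ^ 2 * (((4 : ℕ) : ℝ) + 4)) * α₀) * (1 + 8 * (131072 * (((4 : ℕ) : ℝ) + 1) ^ 2) * (B₁' * (α₀ + α₁))) ≤ 2 ∧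
          2 * (B₁' * (α₀ + α₁)) ≤ c3 4 F.L ∧ ((4 : ℕ) : ℝ) * F.L * α₁ ≤ 1 / 8 ∧ α₀ ≤ cP ∧ α₁ ≤ cP ∧ B₁' * (α₀ + α₁) ≤ cP ∧
          2 * (B₁' * (α₀ + α₁)) ^ 2 + 20 * ((4 : ℕ) : ℝ) * α₀ * (B₁' * (α₀ + α₁)) + 2 * C₂ * (B₁' * (α₀ + α₁)) ^ 2 ≤ α₀ + α₁) ∧
        B8.Thm4Body c₁ B₁' (fun i : {i : ZdIdx 4 F.L // (∀ j, i.Ω j = Set.univ) ∧ (∀ m j, i.Λs m j = {_y | j = m}) ∧ (∀ m j, i.Λb m j = {_c | j = m}) ∧ i.η = ((F.L : ℝ)⁻¹) ^ i.k} => (zdGF3 (Matrix (Fin 2) (Fin 2) ℂ) F.L β len i.1).toGFData) ∧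
        B8.Prop3Body cP 4 (F.L : ℝ) C₂ inp B₀β (fun i : {i : ZdIdx 4 F.L // (∀ j, i.Ω j = Set.univ) ∧ (∀ m j, i.Λs m j = {_y | j = m}) ∧ (∀ m j, i.Λb m j = {_c | j = m}) ∧ i.η = ((F.L : ℝ)⁻¹) ^ i.k} => (zdGF3 (Matrix (Fin 2) (Fin 2) ℂ) F.L β len i.1).toGFData2))
    {G : T4Family → (Site 4 → Fin 4 → (MatA 2)ˣ) → Site 4 → ℕ → ℝ → ℝ → ℝ → Prop} (hGm : ∀ F, RadiiMono 4 (G F))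
    (hG : ∀ (F : T4Family) (U : Site 4 → Fin 4 → (MatA 2)ˣ) (x : Site 4) (K : ℕ) (α₀ α₁ α₂ : ℝ), 2 ≤ K → G F U x K α₀ α₁ α₂ →
      ∃ (u : Site 4 → (MatA 2)ˣ) (a : Site 4 → Fin 4 → MatA 2),
        (∀ z, u z ∈ unitaryUnits (MatA 2)) ∧
        (∀ (y : Site 4) (τ : Fin 4), l1 (y - x) ≤ 2 → ((gaugeAct u U y τ : (MatA 2)ˣ) : MatA 2) = exp (a y τ)) ∧
        (∀ (y : Site 4) (τ : Fin 4), l1 (y - x) ≤ 2 → ‖a y τ‖ ≤ α₀) ∧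
        (∀ (y : Site 4) (τ i : Fin 4), l1 (y - x) ≤ 1 → ‖fd i (fun z => a z τ) y‖ ≤ α₁) ∧
        (∀ (τ i l : Fin 4), ‖fd i (fd l (fun z => a z τ)) x‖ ≤ α₂))
    (C : T4Family → B11Thm1.Consts)
    (hR : ∀ (F : T4Family) (k : ℕ) (ε₁ : ℝ), 0 < ε₁ → ε₁ ≤ (C F).a₁ → ∀ (V U : Site 4 → Fin 4 → (MatA 2)ˣ), V ∈ sfClass 4 F.L (ne3NperOfRecord₁₁ F 0 0) ε₁ 0 →
      IsMinimiser 4 (sfClass 4 F.L (ne3NperOfRecord₁₁ F 0 0) ((C F).B₃ * ε₁)) F.L (ne3NperOfRecord₁₁ F 0 0) (k + 1) V U →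
        ∀ x : Site 4, Regularity (torusVP 4 F.L (ne3NperOfRecord₁₁ F 0 0) (G F) (k + 1)) (C F).B₃ (C F).B₄ ε₁ U (x, F.L ^ (k + 1) - 1 + F.L ^ (k + 1) + 2))
    (h₂ : ∀ β : ℝ, 2 / 3 < β → β < 1 →
    ∀ (𝔯 : RateReading₁₃CoPH 2) (ksel : RunSel) (ℓ : LetterReading) (ℓ₃ : T4Family → Node00.NE3Letters₁₁) (g B : T4Family → ℝ),
      GuardedReadingN16 𝔯 ksel ℓ ℓ₃ g B → KeyedRatesHolderD4V β (rrOfRecord 𝔯 ksel) →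
      ∃ (jc : CutReading) (sh : ShellSplit₁₃CoPH 2 0) (cr : SpineReading), PinnedAtLive jc sh cr ∧
        KeyedRelWeight cr ∧ KeyedShellWeight cr ∧ KeyedExtractionV cr ∧ KeyedCoreEdgeHolderD4V β cr (rrOfRecord 𝔯 ksel)) :
    Summit.QuantumFields.YangMills.Theses.BalabanUVNodes.SpineGivenEndpointR13SepCoPHV :=
  spineGivenEndpointR13SepCoPHV_of_stubTextsV (stub1TextV_of_h5_reg910Slot_match_of_rows β hβ hβ' ℓ g s hs hκ hcr hρ hL h9 hW hS hg h5 hGm hG C hR) h₂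

end Rows

/-! ## §2 Without a coupling-letter input: `g := gradConst 4 ∘ c'` OUTPUT by module 50 (the witness that also meets node N19′'s N16-letter rows) -/

section RowsNoG

variable (β : ℝ) (hβ : 2 / 3 < β) (hβ' : β < 1) (ℓ : LetterReading) (s : (F : T4Family) → Stage13HParams F 2 → ℕ)
  -- the U3 letter block's rows
  (hs : ∀ (F : T4Family) (θ : Stage13HParams F 2), θ.Provisos₁₃CoPH F 2 → (θ.ZhUnity F 2 ∧ θ.SlotsNondegenerate₁₃ F 2) → θ.Admissible F 2 → (ℓ F θ).Signs)
  (hκ : ∀ (F : T4Family) (θ : Stage13HParams F 2), θ.Provisos₁₃CoPH F 2 → (θ.ZhUnity F 2 ∧ θ.SlotsNondegenerate₁₃ F 2) → θ.Admissible F 2 → 0 < (ℓ F θ).κ)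
  (hcr : ∀ (F : T4Family) (θ : Stage13HParams F 2), θ.Provisos₁₃CoPH F 2 → (θ.ZhUnity F 2 ∧ θ.SlotsNondegenerate₁₃ F 2) → θ.Admissible F 2 → betaPrime510 4 1 (ℓ F θ).κ ≤ (ℓ F θ).cr)
  (hρ : ∀ (F : T4Family) (θ : Stage13HParams F 2), θ.Provisos₁₃CoPH F 2 → (θ.ZhUnity F 2 ∧ θ.SlotsNondegenerate₁₃ F 2) → θ.Admissible F 2 → 0 ≤ (ℓ F θ).ρ ∧ (ℓ F θ).ρ < 1)
  -- def-W1's four finite-volume kernel letters of record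
  (hL : ∀ (F : T4Family) (θ : Stage13HParams F 2), θ.Provisos₁₃CoPH F 2 → (θ.ZhUnity F 2 ∧ θ.SlotsNondegenerate₁₃ F 2) → θ.Admissible F 2 → PolLimitsExistOfRecord₁₃ F 2 θ.toStage13Params)
  (h9 : ∀ (F : T4Family) (θ : Stage13HParams F 2), θ.Provisos₁₃CoPH F 2 → (θ.ZhUnity F 2 ∧ θ.SlotsNondegenerate₁₃ F 2) → θ.Admissible F 2 →
    WindowedNE9OfRecord₁₃ F 2 θ.toStage13Params (ℓ F θ).κ (ℓ F θ).moduli)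
  (hW : ∀ (F : T4Family) (θ : Stage13HParams F 2), θ.Provisos₁₃CoPH F 2 → (θ.ZhUnity F 2 ∧ θ.SlotsNondegenerate₁₃ F 2) → θ.Admissible F 2 →
    WindowedDecayOfRecord₁₃ F 2 θ.toStage13Params 0 1 (ℓ F θ).κ)
  (hS : ∀ (F : T4Family) (θ : Stage13HParams F 2), θ.Provisos₁₃CoPH F 2 → (θ.ZhUnity F 2 ∧ θ.SlotsNondegenerate₁₃ F 2) → θ.Admissible F 2 →
    WindowedStepRateOfRecord₁₃ F 2 θ.toStage13Params (s F θ) (ℓ F θ).κ (ℓ F θ).θ₅ ((ℓ F θ).C₅ * (ℓ F θ).θ₅))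
include hβ hβ' hs hκ hcr hρ hL h9 hW hS

/-- ★★ **v6 STUB 1's TEXT FROM `h5` AND THE SLOT KEY WITH THE SQUEEZED LETTERS** — the same WITHOUT a coupling-letter input: module 50's producer OUTPUTS `g := gradConst 4 ∘ c'`
together with letters meeting node N19′'s nine N16-letter rows and the floor `2^78·L^12 ≤ B` (the stub-1 witness dag-n19-w3's `…SqueezedK3V6` reads its `hradii ∕ hclass` off), then
dag-n27-w1's ★★ at that `g`.  NOT a proof of the stub. [cite: Balaban1985Variational, Thm 1 (9)–(10) p.279] [bookkeeping] -/
theorem stub1TextV_of_h5_reg910Slot_squeeze_of_rows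
    (h5 : ∀ F : T4Family, letI : CStarAlgebra (Matrix (Fin 2) (Fin 2) ℂ) := {}
      ∃ (len : Site 4 → ℝ) (c₁ c₁' B₁' cP C₂ B₀β : ℝ) (inp : B8.B9Inputs),
        (∀ v : Site 4, 0 < len v → 1 ≤ len v) ∧ (∀ μ : Fin 4, len (e μ) = 1) ∧ 0 < B₁' ∧ 5 * ((4 : ℕ) : ℝ) * F.L * inp.B₀ ≤ B₁' ∧ 0 < c₁' ∧
        (∀ α₀ α₁ : ℝ, 0 < α₀ → 0 < α₁ → α₀ + α₁ ≤ c₁' →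
          α₀ + α₁ ≤ c₁ ∧ C0 4 * (2 * α₀) ≤ 1 / 3 ∧ 4 * α₀ ≤ c2' 4 F.L ∧ 16 * (B₁' * (α₀ + α₁)) ≤ 1 ∧
          Real.exp (4 * (800 * (((4 : ℕ) : ℝ) + 1) ^ 2 * (((4 : ℕ) : ℝ) + 4)) * α₀) * (1 + 8 * (131072 * (((4 : ℕ) : ℝ) + 1) ^ 2) * (B₁' * (α₀ + α₁))) ≤ 2 ∧
          2 * (B₁' * (α₀ + α₁)) ≤ c3 4 F.L ∧ ((4 : ℕ) : ℝ) * F.L * α₁ ≤ 1 / 8 ∧ α₀ ≤ cP ∧ α₁ ≤ cP ∧ B₁' * (α₀ + α₁) ≤ cP ∧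
          2 * (B₁' * (α₀ + α₁)) ^ 2 + 20 * ((4 : ℕ) : ℝ) * α₀ * (B₁' * (α₀ + α₁)) + 2 * C₂ * (B₁' * (α₀ + α₁)) ^ 2 ≤ α₀ + α₁) ∧
        B8.Thm4Body c₁ B₁' (fun i : {i : ZdIdx 4 F.L // (∀ j, i.Ω j = Set.univ) ∧ (∀ m j, i.Λs m j = {_y | j = m}) ∧ (∀ m j, i.Λb m j = {_c | j = m}) ∧ i.η = ((F.L : ℝ)⁻¹) ^ i.k} => (zdGF3 (Matrix (Fin 2) (Fin 2) ℂ) F.L β len i.1).toGFData) ∧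
        B8.Prop3Body cP 4 (F.L : ℝ) C₂ inp B₀β (fun i : {i : ZdIdx 4 F.L // (∀ j, i.Ω j = Set.univ) ∧ (∀ m j, i.Λs m j = {_y | j = m}) ∧ (∀ m j, i.Λb m j = {_c | j = m}) ∧ i.η = ((F.L : ℝ)⁻¹) ^ i.k} => (zdGF3 (Matrix (Fin 2) (Fin 2) ℂ) F.L β len i.1).toGFData2))
    {G : T4Family → (Site 4 → Fin 4 → (MatA 2)ˣ) → Site 4 → ℕ → ℝ → ℝ → ℝ → Prop} (hGm : ∀ F, RadiiMono 4 (G F))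
    (hG : ∀ (F : T4Family) (U : Site 4 → Fin 4 → (MatA 2)ˣ) (x : Site 4) (K : ℕ) (α₀ α₁ α₂ : ℝ), 2 ≤ K → G F U x K α₀ α₁ α₂ →
      ∃ (u : Site 4 → (MatA 2)ˣ) (a : Site 4 → Fin 4 → MatA 2),
        (∀ z, u z ∈ unitaryUnits (MatA 2)) ∧
        (∀ (y : Site 4) (τ : Fin 4), l1 (y - x) ≤ 2 → ((gaugeAct u U y τ : (MatA 2)ˣ) : MatA 2) = exp (a y τ)) ∧
        (∀ (y : Site 4) (τ : Fin 4), l1 (y - x) ≤ 2 → ‖a y τ‖ ≤ α₀) ∧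
        (∀ (y : Site 4) (τ i : Fin 4), l1 (y - x) ≤ 1 → ‖fd i (fun z => a z τ) y‖ ≤ α₁) ∧
        (∀ (τ i l : Fin 4), ‖fd i (fd l (fun z => a z τ)) x‖ ≤ α₂))
    (C : T4Family → B11Thm1.Consts)
    (hR : ∀ (F : T4Family) (k : ℕ) (ε₁ : ℝ), 0 < ε₁ → ε₁ ≤ (C F).a₁ → ∀ (V U : Site 4 → Fin 4 → (MatA 2)ˣ), V ∈ sfClass 4 F.L (ne3NperOfRecord₁₁ F 0 0) ε₁ 0 →
      IsMinimiser 4 (sfClass 4 F.L (ne3NperOfRecord₁₁ F 0 0) ((C F).B₃ * ε₁)) F.L (ne3NperOfRecord₁₁ F 0 0) (k + 1) V U →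
        ∀ x : Site 4, Regularity (torusVP 4 F.L (ne3NperOfRecord₁₁ F 0 0) (G F) (k + 1)) (C F).B₃ (C F).B₄ ε₁ U (x, F.L ^ (k + 1) - 1 + F.L ^ (k + 1) + 2)) :
    ∃ β : ℝ, 2 / 3 < β ∧ β < 1 ∧
    ∃ (𝔯 : RateReading₁₃CoPH 2) (ksel : RunSel) (ℓ : LetterReading) (ℓ₃ : T4Family → Node00.NE3Letters₁₁) (g B : T4Family → ℝ),
      GuardedReadingN16 𝔯 ksel ℓ ℓ₃ g B ∧ KeyedRatesHolderD4V β (rrOfRecord 𝔯 ksel) := by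
  have hβ0 : 0 ≤ β := by linarith
  obtain ⟨ℓ₃, g, B, _c', -, hE, hM', -, -, hH⟩ := exists_letters_g_n16HolderAtReading_loose_squeezeFull_of_h5_reg910Slot (N := 2) hβ0 hβ'.le h5 hGm hG C hR
  exact stub1TextV_of_n16Producer_of_rows β hβ hβ' ℓ g s hs hκ hcr hρ hL h9 hW hS ⟨ℓ₃, B, hE, hM', hH⟩

end RowsNoG

end

end Summit.QuantumFields.YangMills.BalabanUVNodes.N16Stub1RoadOfSlotKey
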